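import Literature.Algebra.Module.TorsionPairingDualityDVR
import HarnessLib

/-!
# Lagrangian submodules of a split rank-four torsion pairing over a DVR, I: the setting, and
# `A ∩ V_f` as the annihilator of `pr_tr(A)` (Howard 2004, Lemmas 1.5.7–1.5.8 — the module theory)

Topic `Algebra/Module`; namespace `Literature.Algebra.Module` (sequel to `TorsionHomCountingDVR.lean` and
`TorsionPairingDualityDVR.lean`; continued in `LagrangianSubmodulesDeltaTransfer.lean`, which holds §3–§4).
THEOREMS ONLY: no definition, no named fact, no instance, no `sorry`. Cell `pub/bsd-print-x9`, print leaf G87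
`Literature.NumberTheory.GaloisCohomology.Howard2004.thm161_dvrKolyvaginBound` (Howard 2004 Thm. 1.6.1) ⟸
Lemma 1.6.4 ⟸ §1.5; this file and its sequel are the module theory of Lemmas 1.5.7–1.5.8 and Prop. 1.5.9. The
Galois-cohomological inputs are HYPOTHESES here, in the shape the source prints them: the maximal isotropy
«`A = A^⟂`» of the image `A` of `𝓗^ℓ(n)` in `H¹(K_ℓ, T)` (Lemma 1.5.6 = global duality + reciprocity), the
splitting `H¹(K_ℓ,T) = H¹_f ⊕ H¹_tr` into free rank-two isotropic summands (Prop. «locally free», H.4 at `ℓ`,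
arXiv p0009 L105–108), and the identifications `loc_ℓ 𝓗(n) = A ∩ H¹_f`, `loc_ℓ 𝓗(nℓ) = A ∩ H¹_tr`
(definitions of `𝓕(n)`, `𝓕(nℓ)` at `ℓ`).

SOURCE, verbatim. B. Howard, *The Heegner point Kolyvagin system*, Compositio Math. **140** (2004) 1439–1472
(= arXiv:1202.6340 §2.5, held text). Lemma 1.5.7 (p0010 L105–L139): «For some `δ ≥ 0`,
`𝓗^ℓ(n)/(𝓗(n)+𝓗(ℓn)) ≅ (R/𝔪^δ)²`. *Proof.* We first construct a non-degenerate, alternating, `R`-bilinear,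
`R`-valued pairing on the module `𝓗^ℓ(n)/(𝓗(n)+𝓗(ℓn))`. Let `A` be the local image of `𝓗^ℓ(n)` in
`H¹(K_ℓ,T)`. `A` is maximal isotropic by the previous lemma. Write `A_f` and `A_tr` for the intersections of `A`
with `H¹_f(K_ℓ,T)` and `H¹_tr(K_ℓ,T)`, respectively. Localization at `ℓ` gives an isomorphism
`𝓗^ℓ(n)/(𝓗(n)+𝓗(ℓn)) ≅ A/(A_f+A_tr)` […] For `x, y ∈ A` we define the symbol `[x,y] ∈ R` by
`[x,y] = ⟨x_f, y_tr⟩`. That `[x,y] = −[y,x]` follows immediately from `⟨x,y⟩ = 0` and the isotropy of the finite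
and transverse submodules. Suppose `x ∈ A` is in the kernel of this pairing, then `0 = ⟨x_f,y_tr⟩ = ⟨x_f,y⟩`
for every `y ∈ A` and so `x_f ∈ A` by maximal isotropy of `A`. It follows that `x_tr ∈ A` and so
`x ∈ A_f + A_tr` […] can be generated by two elements. Therefore `D` is cyclic.» Lemma 1.5.8 (p0010
L142–L154): «There are `a`, `b`, and `δ` greater than or equal to zero such that in the following diagram the
cokernel of each inclusion is a direct sum of two cyclic `R`-modules of the indicated lengths.» Prop. 1.5.9
(p0010 L156 – p0011 L13): «`loc_ℓ(Stub(n)) = 0 ⟹ loc_ℓ(Stub(ℓn)) = 0`. *Proof.* […] `loc_ℓ(Stub(n)) = 0`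
implies that `𝔪^{λ(n)}` kills the lower left quotient, and so `a, b ≤ λ(n)`. The diagram immediately implies
`λ(nℓ) = λ(n)+k−a−b−δ ≥ k−a−δ, k−b−δ` so that `𝔪^{λ(nℓ)}` kills the lower right quotient.» Here `R` is
principal Artinian of length `k` = `R/(ϖᵏ)` for a DVR `(R, ϖ)`, and «`R`-valued» = `R/(ϖᵏ)`-valued.

SETTING (all hypotheses explicit; `R` a DVR, `hϖ : Irreducible ϖ`): an `R`-module `V` with complementary
submodules `V_f`, `V_tr` (`hc : IsCompl Vf Vtr`), each `≃ₗ[R] (Fin 2 → R ⧸ span{ϖᵏ})` (`ef`, `etr`); an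
`R`-bilinear SYMMETRIC form `B : V →ₗ V →ₗ P` (`hsymm`), values in `P` with cyclic `ϖ`-torsion (`hP`, e.g.
`P = R/(ϖᵏ)`), NON-DEGENERATE (`hnd : ∀ x, (∀ y, B x y = 0) → x = 0`), `V_f` and `V_tr` ISOTROPIC (`hf`,
`htr`); `2 ∈ R^×` (`h2`, i.e. `p` odd — needed for `[a,a] = 0`); a submodule `A ≤ V` with
`hA : ∀ x, x ∈ A ↔ ∀ a ∈ A, B x a = 0` («`A = A^⟂`»). Notation: `pr_tr = Vtr.projectionOnto Vf hc.symm`,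
`pr_tr(A) = A.map pr_tr ≤ V_tr`, `A ∩ V_tr` either as `A ⊓ Vtr ≤ V` or as `A.comap Vtr.subtype ≤ V_tr`.

WHAT IS PROVED:
* §1 `apply_eq_apply_projection_add`, `injective_domRestrict₁₂_of_isotropic` (the restricted pairing
  `V_f → Hom(V_tr, P)` is injective), `bijective_domRestrict₁₂_of_isotropic` (… and bijective, by the counting
  of `TorsionHomCountingDVR`).
* §2 **`mem_iff_forall_map_projectionOnto_apply_eq_zero`** («`x_f ∈ A` by maximal isotropy of `A`»:
  `A ∩ V_f` is the annihilator of `pr_tr(A)`), `comap_subtype_le_map_projectionOnto` (`A ∩ V_tr ≤ pr_tr(A)`),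
  **`pow_smul_top_le_map_projectionOnto`** (`ϖ^λ(A ∩ V_f) = 0 ⟹ ϖ^λ V_tr ≤ pr_tr(A)` — «`a, b ≤ λ`»),
  **`length_inf_le_length_quotient_map_projectionOnto`** (`ℓ(A ∩ V_f) ≤ ℓ(V_tr/pr_tr(A))` — the upper-left
  cokernel is dual to the lower-left one).
* §3–§4 (Lemma 1.5.7's pairing, the `δ` of Lemma 1.5.8, Prop. 1.5.9's transfer): in the sequel
  `LagrangianSubmodulesDeltaTransfer.lean`.

DICTIONARY for the consumer (Howard p0010): `V = H¹(K_ℓ, T^{(k)})`, `V_f = H¹_f(K_ℓ,T)`,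
`V_tr = H¹_tr(K_ℓ,T)`, `⟨ , ⟩` = the local Tate pairing of H.4 (symmetric by «flippity», p0009 L66–L73),
`A = loc_ℓ 𝓗^ℓ(n)`, `A ∩ V_f = loc_ℓ 𝓗(n)`, `A ∩ V_tr = loc_ℓ 𝓗(nℓ)`, `pr_tr(A) ≅ 𝓗^ℓ(n)/𝓗(n)`,
`λ = λ(n)`, `λ' = λ(nℓ)`; the conclusion is `loc_ℓ(Stub(nℓ)) = 0`.

NOT HERE: Lemma 1.5.6 itself (global duality), Lemma 1.5.3 / Prop. 1.5.5 (parity; x10b-p1-w5's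
`IsotropicLineParity.lean`), the localisation identifications (x9-p1-w3 g14), the induction of Lemma 1.6.4
(x10b-p1-w2 g15's engine, whose input `h159` this transfer feeds); `thm161_dvrKolyvaginBound` is NOT proved by
this file. References: [Howard2004HeegnerKolyvagin] §1.5.
-/

noncomputable section

open Module Submodule
open scoped Pointwise

namespace Literature.Algebra.Module

universe u v w

section Lagrangian

variable {R : Type u} [CommRing R] [IsDomain R] [IsDiscreteValuationRing R] {ϖ : R}
variable {V : Type v} [AddCommGroup V] [Module R V]
variable {P : Type w} [AddCommGroup P] [Module R P]

/-! ### §1 The split setting: `V = V_f ⊕ V_tr`, both isotropic, `⟨ , ⟩` symmetric and non-degenerate -/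

omit [IsDomain R] [IsDiscreteValuationRing R] in
/-- `⟨x, v⟩ = ⟨x, v_f⟩ + ⟨x, v_tr⟩` along `V = V_f ⊕ V_tr`. [cite: Howard2004HeegnerKolyvagin, Lemma 1.5.7, proof (arXiv:1202.6340 Lemma 2.5.7, p0010 L122–L124)] -/
theorem apply_eq_apply_projection_add (B : V →ₗ[R] V →ₗ[R] P) {Vf Vtr : Submodule R V}
    (hc : IsCompl Vf Vtr) (x v : V) :
    B x v = B x (Vf.projectionOnto Vtr hc v : V) + B x (Vtr.projectionOnto Vf hc.symm v : V) := by
  conv_lhs => rw [← Submodule.projection_add_projection_eq_self hc v]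
  rw [map_add]
  rfl

omit [IsDomain R] [IsDiscreteValuationRing R] in
/-- **Left non-degeneracy of the restricted pairing `V_f × V_tr → P`**: if `⟨ , ⟩` is non-degenerate on `V`
and `V_f` is isotropic, then `f ↦ ⟨f, ·⟩|_{V_tr}` is injective on `V_f`.
[cite: Howard2004HeegnerKolyvagin, Lemma 1.5.7, proof (arXiv:1202.6340 Lemma 2.5.7, p0010 L124–L131)] -/
theorem injective_domRestrict₁₂_of_isotropic (B : V →ₗ[R] V →ₗ[R] P)
    (hnd : ∀ x : V, (∀ y, B x y = 0) → x = 0) {Vf Vtr : Submodule R V} (hc : IsCompl Vf Vtr)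
    (hf : ∀ x ∈ Vf, ∀ y ∈ Vf, B x y = 0) : Function.Injective (B.domRestrict₁₂ Vf Vtr) := by
  refine (injective_iff_map_eq_zero _).mpr fun f hf0 => ?_
  apply Subtype.ext
  refine hnd _ fun y => ?_
  rw [apply_eq_apply_projection_add B hc, hf _ f.2 _ (Vf.projectionOnto Vtr hc y).2, zero_add]
  have := LinearMap.congr_fun hf0 (Vtr.projectionOnto Vf hc.symm y)
  rwa [LinearMap.domRestrict₁₂_apply, LinearMap.zero_apply] at this

/-- **Perfectness of `V_f × V_tr → P` by counting**: with `V_f ≅ V_tr ≅ (R/(ϖᵏ))²`, `P` with cyclic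
`ϖ`-torsion, `⟨ , ⟩` non-degenerate and `V_f` isotropic, every `R`-linear `V_tr → P` is `⟨f, ·⟩` for a unique
`f ∈ V_f`. [cite: Howard2004HeegnerKolyvagin, Lemma 1.5.6, proof (arXiv:1202.6340 Lemma 2.5.6, p0010 L94–L102)] -/
theorem bijective_domRestrict₁₂_of_isotropic (hϖ : Irreducible ϖ) {k : ℕ}
    (hP : ∀ p q : P, ϖ • p = 0 → ϖ • q = 0 → p ≠ 0 → ∃ r : R, q = r • p)
    (B : V →ₗ[R] V →ₗ[R] P) (hnd : ∀ x : V, (∀ y, B x y = 0) → x = 0) {Vf Vtr : Submodule R V}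
    (hc : IsCompl Vf Vtr) (ef : ↥Vf ≃ₗ[R] (Fin 2 → R ⧸ Ideal.span {ϖ ^ k}))
    (etr : ↥Vtr ≃ₗ[R] (Fin 2 → R ⧸ Ideal.span {ϖ ^ k})) (hf : ∀ x ∈ Vf, ∀ y ∈ Vf, B x y = 0) :
    Function.Bijective (B.domRestrict₁₂ Vf Vtr) := by
  haveI : Module.Finite R ↥Vtr := Module.Finite.equiv etr.symm
  refine bijective_of_injective_of_length_le hϖ (uniformizer_pow_smul_eq_zero_of_linearEquiv etr) hP
    (B.domRestrict₁₂ Vf Vtr) (injective_domRestrict₁₂_of_isotropic B hnd hc hf) (le_of_eq ?_) ?_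
  · rw [ef.length_eq, etr.length_eq]
  · rw [ef.length_eq, Module.length_pi_of_fintype, Finset.sum_const, Finset.card_univ, Fintype.card_fin,
      length_quotient_uniformizer_pow hϖ]
    exact ENat.coe_ne_top (2 • k)

/-! ### §2 A Lagrangian `A = A^⟂`: `A ∩ V_f` is the annihilator of `pr_tr(A)` -/

omit [IsDomain R] [IsDiscreteValuationRing R] in
/-- **«`x_f ∈ A` by maximal isotropy of `A`»**: for `A = A^⟂` and `f ∈ V_f`: `f ∈ A ↔ ⟨f, pr_tr(A)⟩ = 0` — the
submodule `A ∩ V_f` is the annihilator in `V_f` of the projection `pr_tr(A) ≤ V_tr`.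
[cite: Howard2004HeegnerKolyvagin, Lemma 1.5.7, proof (arXiv:1202.6340 Lemma 2.5.7, p0010 L127–L131)] -/
theorem mem_iff_forall_map_projectionOnto_apply_eq_zero (B : V →ₗ[R] V →ₗ[R] P)
    {Vf Vtr : Submodule R V} (hc : IsCompl Vf Vtr) (hf : ∀ x ∈ Vf, ∀ y ∈ Vf, B x y = 0)
    (A : Submodule R V) (hA : ∀ x, x ∈ A ↔ ∀ a ∈ A, B x a = 0) (f : ↥Vf) :
    (f : V) ∈ A ↔ ∀ t ∈ A.map (Vtr.projectionOnto Vf hc.symm), B f t = 0 := by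
  constructor
  · rintro hfA _ ⟨a, ha, rfl⟩
    have h := apply_eq_apply_projection_add B hc (f : V) a
    rw [(hA _).mp hfA a ha, hf _ f.2 _ (Vf.projectionOnto Vtr hc a).2, zero_add] at h
    exact h.symm
  · intro h
    refine (hA _).mpr fun a ha => ?_
    rw [apply_eq_apply_projection_add B hc, hf _ f.2 _ (Vf.projectionOnto Vtr hc a).2, zero_add]
    exact h _ (Submodule.mem_map_of_mem ha)

omit [IsDomain R] [IsDiscreteValuationRing R] in
/-- `A ∩ V_tr ≤ pr_tr(A)`. [cite: Howard2004HeegnerKolyvagin, Lemma 1.5.7, proof (arXiv:1202.6340 Lemma 2.5.7, p0010 L112–L119)] -/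
theorem comap_subtype_le_map_projectionOnto {Vf Vtr : Submodule R V} (hc : IsCompl Vf Vtr)
    (A : Submodule R V) : A.comap Vtr.subtype ≤ A.map (Vtr.projectionOnto Vf hc.symm) :=
  fun t ht => ⟨t, ht, Submodule.projectionOnto_apply_left hc.symm t⟩

/-- **«`𝔪^λ` kills the lower left quotient ⟹ `a, b ≤ λ`», dual form**: if `ϖ^λ (A ∩ V_f) = 0` then
`ϖ^λ V_tr ≤ pr_tr(A)`. [cite: Howard2004HeegnerKolyvagin, Prop. 1.5.9, proof (arXiv:1202.6340 Prop. 2.5.9, p0011 L5–L6)] -/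
theorem pow_smul_top_le_map_projectionOnto (hϖ : Irreducible ϖ) {k : ℕ}
    (hP : ∀ p q : P, ϖ • p = 0 → ϖ • q = 0 → p ≠ 0 → ∃ r : R, q = r • p)
    (B : V →ₗ[R] V →ₗ[R] P) (hnd : ∀ x : V, (∀ y, B x y = 0) → x = 0)
    {Vf Vtr : Submodule R V} (hc : IsCompl Vf Vtr) (ef : ↥Vf ≃ₗ[R] (Fin 2 → R ⧸ Ideal.span {ϖ ^ k}))
    (etr : ↥Vtr ≃ₗ[R] (Fin 2 → R ⧸ Ideal.span {ϖ ^ k})) (hf : ∀ x ∈ Vf, ∀ y ∈ Vf, B x y = 0)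
    (htr : ∀ x ∈ Vtr, ∀ y ∈ Vtr, B x y = 0)
    (A : Submodule R V) (hA : ∀ x, x ∈ A ↔ ∀ a ∈ A, B x a = 0) {lam : ℕ}
    (hlam : ∀ a ∈ A ⊓ Vf, ϖ ^ lam • a = 0) :
    ϖ ^ lam • (⊤ : Submodule R ↥Vtr) ≤ A.map (Vtr.projectionOnto Vf hc.symm) := by
  haveI : Module.Finite R ↥Vtr := Module.Finite.equiv etr.symm
  -- a test element of exact order `ϖ^k`, from the (injective) pairing `V_tr → Hom(V_f, P)`
  have hinj' : Function.Injective (B.domRestrict₁₂ Vtr Vf) :=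
    injective_domRestrict₁₂_of_isotropic B hnd hc.symm htr
  obtain ⟨p₀, hp₀, hp₀'⟩ := exists_smul_eq_zero_and_dvd_of_injective hϖ etr (B.domRestrict₁₂ Vtr Vf) hinj'
  refine pow_smul_top_le_of_forall_mem hϖ (uniformizer_pow_smul_eq_zero_of_linearEquiv etr)
    (B.domRestrict₁₂ Vf Vtr) (bijective_domRestrict₁₂_of_isotropic hϖ hP B hnd hc ef etr hf).2 hp₀ hp₀'
    (A.comap Vf.subtype) _ (fun f hf0 => ?_) (fun f hfA => ?_)
  · rw [Submodule.mem_comap, Submodule.subtype_apply,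
      mem_iff_forall_map_projectionOnto_apply_eq_zero B hc hf A hA]
    intro t ht
    have := hf0 t ht
    rwa [LinearMap.domRestrict₁₂_apply] at this
  · apply Subtype.ext
    rw [Submodule.coe_smul, Submodule.coe_zero]
    exact hlam _ ⟨hfA, f.2⟩

/-- **«the upper left quotient is dual to the lower left one»**, as a length bound:
`ℓ(A ∩ V_f) ≤ ℓ(V_tr / pr_tr(A))`. [cite: Howard2004HeegnerKolyvagin, Lemma 1.5.8, proof (arXiv:1202.6340 Lemma 2.5.8, p0010 L147–L150)] -/
theorem length_inf_le_length_quotient_map_projectionOnto (hϖ : Irreducible ϖ) {k : ℕ}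
    (hP : ∀ p q : P, ϖ • p = 0 → ϖ • q = 0 → p ≠ 0 → ∃ r : R, q = r • p)
    (B : V →ₗ[R] V →ₗ[R] P) (hnd : ∀ x : V, (∀ y, B x y = 0) → x = 0)
    {Vf Vtr : Submodule R V} (hc : IsCompl Vf Vtr)
    (etr : ↥Vtr ≃ₗ[R] (Fin 2 → R ⧸ Ideal.span {ϖ ^ k})) (hf : ∀ x ∈ Vf, ∀ y ∈ Vf, B x y = 0)
    (A : Submodule R V) (hA : ∀ x, x ∈ A ↔ ∀ a ∈ A, B x a = 0) :
    Module.length R ↥(A ⊓ Vf) ≤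
      Module.length R (↥Vtr ⧸ A.map (Vtr.projectionOnto Vf hc.symm)) := by
  haveI : Module.Finite R ↥Vtr := Module.Finite.equiv etr.symm
  have hco : (A ⊓ Vf).comap Vf.subtype = A.comap Vf.subtype := by
    rw [Submodule.comap_inf, Submodule.comap_subtype_self, inf_top_eq]
  rw [← (Submodule.comapSubtypeEquivOfLe (inf_le_right : A ⊓ Vf ≤ Vf)).length_eq, hco]
  refine length_le_length_quotient_of_forall_apply_eq_zero hϖ
    (uniformizer_pow_smul_eq_zero_of_linearEquiv etr) hP (B.domRestrict₁₂ Vf Vtr)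
    (injective_domRestrict₁₂_of_isotropic B hnd hc hf) _ _ (fun f hfA t ht => ?_)
  rw [LinearMap.domRestrict₁₂_apply]
  exact (mem_iff_forall_map_projectionOnto_apply_eq_zero B hc hf A hA f).mp hfA t ht

end Lagrangian

end Literature.Algebra.Module
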